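import Literature.NumberTheory.EllipticCurves.Rank1Residual.Typed.CasselsLowerBound
import Literature.NumberTheory.EllipticCurves.Rank1Residual.Typed.X11
import HarnessLib

/-!
# X11 at `p ≥ 5`, rank `0`: the typed LOWER bound is discharged by the finite certificate `Ш(E)[p] ≠ 0` (cell `b2b-bsdres`)

HONEST FRAMING (run/shared/lean/b2b/bsd-rank1-residual/, verbatim): the goal of the cell is to
DELETE the COMBINATION-SHAPED residual classes for ALL analytic-rank `≤ 1` elliptic curves over `ℚ`
— "full BSD formula for every rank `≤ 1` curve in class C" assembled STRICTLY from published
theorems — so that the rank-`≤ 1` remainder becomes exactly the CONSTRUCTION-SHAPED classes, which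
are TYPED (missing-input `Prop`s), NOT attempted. This is not "finishing BSD".

Theorems only (no definition, no new named fact; prover x11a gen 8). The general-`p` companion of
the `p = 3` instances `X11ThreeRankZero.missingInputAt_of_casselsTate_of_three_dvd` /
`X11ThreeRankZero.bsdp_of_casselsTate_of_three_dvd` of `Typed/CasselsLowerBound.lean` (prover x11b):
on the rank-`0` clause of X11 (`mult(p) ∧ irr(p) ∧ ¬ram(p) ∧ r = 0`) at ANY odd `p` with
`ρ̄_{E,p}` surjective, the typed missing input `X11RankZero.MissingInputAt W p` of `Typed/X11.lean`
— the LOWER bound `ord_p #Ш_an ≤ ord_p #Ш` (the upper bound being Wuthrich 2014 Prop. 21) — is NOT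
a missing theorem when `ord_p #Ш(E/ℚ)_an ≤ 2k`: it is the finite certificate `p^{2k-1} ∣ #Ш(E/ℚ)`
(for `k = 1`: ONE non-zero element of `Ш(E/ℚ)[p]`), by Cassels–Tate squareness
(`missingLowerBoundAt_of_casselsTate_of_pow_dvd`). Composed with the canonical conditional class
theorem `X11RankZero.bsdp_of_missingInputAt` this gives `BSD(E,p)` from PUBLISHED theorems
(Wuthrich 2014 Prop. 21, Cassels 1962 / Silverman AEC X.4.14, Gross–Zagier–Kolyvagin, modularity)
plus the per-curve certificate. SUB-class statements; NOT a deletion of X11's rank-`0` clause (pairs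
with `ord_p #Ш_an > 2k` for every certified `k`, or with a non-surjective irreducible image, stay
typed); the certificate is CONSTRUCTION-shaped (a `p`-descent / visibility computation; lane's).

**Where it bites** (lane collector 2026-08-18T19:14:57Z = RESIDUAL-CASES v5, complete for
`N < 2·10⁴`; `Typed/X11.lean` census addendum gen 4; this seat's recount from
`bsdN/RESIDUE.jsonl` + Cremona `allcurves`/`allbsd`, `b2b-bsdres-x11a/REPORT-g8.md`): of the 615
rank-`0` X11-type pairs at `p ≥ 5` (all `¬ram`, all with `ρ̄_{E,p}` surjective) exactly TWO have
`p ∣ #Ш_an`, both with `#Ш_an = 25` at `p = 5` and `#E(ℚ)_tors = 1`, `∏ c_v = 2`: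
`10580l1` (`N = 2²·5·23²`, `[0,-1,0,-519125,-143810335]`, SPLIT multiplicative at `5`,
`v₅(Δ_min) = 1`) and `17640l1` (`N = 2³·3²·5·7²`, `[0,0,0,3697197,-86239122802]`, NON-split
multiplicative at `5`, `v₅(Δ_min) = 7`). For each, `BSD(E,5)` ⇐ [the four published inputs] +
[ONE certificate: `Ш(E/ℚ)[5] ≠ 0`] (`X11RankZero.bsdp_of_casselsTate_of_dvd`, `k = 1`). Both are
"très ramifié" at `5` (`5 ∤ v₅(Δ_min)`), so `E[5]` is not finite at `5` and no weight-`2` newform of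
level prime to `5` is congruent to `f_E` (Ribet 1990 / Edixhoven 1992): the Hida-family transfer of
REPORT-g8.md §2 has no good-ordinary partner to start from at these two pairs. Nothing here changes
a verdict or a label (the lane certifies).

References: Cassels 1962 [Cassels1962ArithmeticIV]; Silverman AEC X.4.14 [SilvermanAEC2009];
Wuthrich 2014 Prop. 21 [Wuthrich2014]; Miller 2011 Def. 1.1 [Miller2011LMS]; cell files
`Typed/CasselsLowerBound.lean` (x11b), `Typed/X11.lean` (x11a), REFEREE.md R6.2/R6.3.
-/

noncomputable section

open scoped Classical

open WeierstrassCurve Literature.NumberTheory.EllipticCurves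
  Literature.NumberTheory.EllipticCurves.Rank1Residual
  Literature.NumberTheory.EllipticCurves.Wuthrich2014

namespace Literature.NumberTheory.EllipticCurves.Rank1Residual.Typed

variable (W : WeierstrassCurve ℚ) [W.IsElliptic] (p : ℕ) [Fact p.Prime]

/-- **X11, rank `0`, any prime `p`, surjective `ρ̄_{E,p}`: the typed rank-zero input is DISCHARGED
by the finite certificate.** If `ord_{s=1} L(E,s) = 0`, `#Ш(E/ℚ)_an` is a rational `q` with
`ord_p q ≤ 2k` and `p^{2k-1} ∣ #Ш(E/ℚ)`, then `X11RankZero.MissingInputAt W p` holds: its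
lower-bound conjunct by Cassels–Tate squareness (`hCT` = bsd.S18,
`missingLowerBoundAt_of_casselsTate_of_pow_dvd`; `Ш` finite by Gross–Zagier–Kolyvagin `hGZK`), its
non-surjective conjunct vacuously. NOT a class theorem (the certificate is per curve).
[cite: SilvermanAEC2009, Thm. X.4.14] [cite: Miller2011LMS, Def. 1.1 (arXiv:1010.2431 p. 3)] -/
theorem X11RankZero.missingInputAt_of_casselsTate_of_pow_dvd
    (hCT : exists_casselsTate_pairing (K := ℚ))
    (hGZK : rank_eq_analyticRank_of_analyticRank_le_one) (hr : W.analyticRank = 0)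
    (hsurj : Surj W p) {q : ℚ} (hq : shaAn W = (q : ℂ)) {k : ℕ} (hv : padicValRat p q ≤ 2 * k)
    (hdvd : p ^ (2 * k - 1) ∣ W.shaOrder) : X11RankZero.MissingInputAt W p :=
  ⟨fun _ => missingLowerBoundAt_of_casselsTate_of_pow_dvd W p hCT (hGZK W (by omega)).2 hq hv hdvd,
    fun h => absurd hsurj h⟩

/-- **The `k = 1` case** (`ord_p #Ш_an ≤ 2`, certificate `p ∣ #Ш(E/ℚ)`, i.e. `Ш(E/ℚ)[p] ≠ 0` via
`dvd_shaOrder_of_exists_torsion`) — the shape met at the two census pairs `10580l1@5`,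
`17640l1@5` (`#Ш_an = 25`). [cite: SilvermanAEC2009, Thm. X.4.14]
[cite: Miller2011LMS, Def. 1.1 (arXiv:1010.2431 p. 3)] -/
theorem X11RankZero.missingInputAt_of_casselsTate_of_dvd
    (hCT : exists_casselsTate_pairing (K := ℚ))
    (hGZK : rank_eq_analyticRank_of_analyticRank_le_one) (hr : W.analyticRank = 0)
    (hsurj : Surj W p) {q : ℚ} (hq : shaAn W = (q : ℂ)) (hv : padicValRat p q ≤ 2)
    (hdvd : p ∣ W.shaOrder) : X11RankZero.MissingInputAt W p :=
  X11RankZero.missingInputAt_of_casselsTate_of_pow_dvd W p hCT hGZK hr hsurj hq (k := 1)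
    (by simpa using hv) (by simpa using hdvd)

variable [W.IsGloballyMinimal]

/-- **X11 ∧ `r = 0` at an odd `p` with `ρ̄_{E,p}` surjective and `ord_p #Ш_an ≤ 2k`: `BSD(E,p)`
from PUBLISHED theorems plus the finite certificate `p^{2k-1} ∣ #Ш(E/ℚ)`.** Inputs: Wuthrich 2014
Prop. 21 (`hW`: multiplicative `p` is not additive, surjective image — the UPPER bound),
Cassels–Tate squareness (`hCT` — turns the certificate into the LOWER bound), Gross–Zagier–Kolyvagin
(`hGZK`), modularity (`hmod`); composed through the cell's canonical conditional class theorem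
`X11RankZero.bsdp_of_missingInputAt`. SUB-class statement; NOT a deletion of X11's rank-`0` clause.
[cite: Wuthrich2014, Prop. 21 (p. 400)] [cite: SilvermanAEC2009, Thm. X.4.14]
[cite: Miller2011LMS, §1 and Def. 1.1] -/
theorem X11RankZero.bsdp_of_casselsTate_of_pow_dvd (hCT : exists_casselsTate_pairing (K := ℚ))
    (hW : sha_dvd_analyticSha) (hGZK : rank_eq_analyticRank_of_analyticRank_le_one)
    (hmod : hasEntireLFunction_rat) (hp : p ≠ 2) (hr : W.analyticRank = 0) (hX : ClassX11 W p)
    (hsurj : Surj W p) {q : ℚ} (hq : shaAn W = (q : ℂ)) {k : ℕ} (hv : padicValRat p q ≤ 2 * k)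
    (hdvd : p ^ (2 * k - 1) ∣ W.shaOrder) : BSDp W p :=
  X11RankZero.bsdp_of_missingInputAt hW hGZK hmod W p hp hr hX
    (X11RankZero.missingInputAt_of_casselsTate_of_pow_dvd W p hCT hGZK hr hsurj hq hv hdvd)

/-- **X11 ∧ `r = 0` at an odd `p`, surjective `ρ̄_{E,p}`, `ord_p #Ш_an ≤ 2`, ONE certificate
`p ∣ #Ш(E/ℚ)` (`Ш(E/ℚ)[p] ≠ 0`) ⇒ `BSD(E,p)`.** Census (`N < 2·10⁴`, `p ≥ 5`): exactly the two
rank-`0` X11 pairs not closed by `bsdp_of_classX11_rankZero_surj_of_shaAn_unit` — `10580l1@5`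
(split, `v₅(Δ_min) = 1`) and `17640l1@5` (non-split, `v₅(Δ_min) = 7`), `#Ш_an = 25`,
`#E(ℚ)_tors = 1`, `∏ c_v = 2` — become per-curve certificate candidates (certificate
`Ш(E)[5] ≠ 0`: a `5`-descent or a visibility computation; lane to run and to rule).
[cite: Wuthrich2014, Prop. 21 (p. 400)] [cite: SilvermanAEC2009, Thm. X.4.14]
[cite: Miller2011LMS, §1 and Def. 1.1] -/
theorem X11RankZero.bsdp_of_casselsTate_of_dvd (hCT : exists_casselsTate_pairing (K := ℚ))
    (hW : sha_dvd_analyticSha) (hGZK : rank_eq_analyticRank_of_analyticRank_le_one)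
    (hmod : hasEntireLFunction_rat) (hp : p ≠ 2) (hr : W.analyticRank = 0) (hX : ClassX11 W p)
    (hsurj : Surj W p) {q : ℚ} (hq : shaAn W = (q : ℂ)) (hv : padicValRat p q ≤ 2)
    (hdvd : p ∣ W.shaOrder) : BSDp W p :=
  X11RankZero.bsdp_of_casselsTate_of_pow_dvd W p hCT hW hGZK hmod hp hr hX hsurj hq (k := 1)
    (by simpa using hv) (by simpa using hdvd)

end Literature.NumberTheory.EllipticCurves.Rank1Residual.Typed
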